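/-
Copyright (c) 2026 the pub-hodgecm-mathlib formalisation cell (harness21).  Prover seat hodgecm-mathlib-K2Liu-p11 (g2), Track B «K2-LIT»,
#184♮ = hLiu418 = `stmt-HodgeConjecture-24832`; organ (σ) A7-val, V6-inst LETTER 1b (LEAD F0P6-plan (g14) BATCH #13∕#16; K2Liu-p09 (g6) I-2 dictionary 13:17:50Z).
THEOREMS ONLY (no `def`, no `instance`, no notation, no named-fact hypothesis, no `sorry`).
-/
import Literature.NumberTheory.Automorphic.UnitaryGroupPureTensorEulerProduct   -- ★ `secondCountableTopology_localPi`, `locallyCompactSpace_localPi`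
import Mathlib.MeasureTheory.Measure.Haar.Basic
import HarnessLib

/-!
# Crux `HLiu418`, (σ) V6-inst LETTER 1b, §1: THE TOPOLOGICAL ∕ HAAR INSTANCE BUNDLE ON THE LOCAL UNITARY FACTOR `U(J)(F_v) = UnitaryGroup.localPi E c N J v`
# — the instance binders of ★ V8d `K2LiuA7ValueFace.exists_average` at `G := U(V′_v)` (K2Liu-p09's I-2: `G := localPi L c M₂ (diagonal dV′) v`)

Cell `hodgecm-mathlib`, crux item hLiu418 = `stmt-HodgeConjecture-24832` (helper lane `--supports`, count-neutral).

★ V8d `exists_average` is stated over an abstract `G` with `[SecondCountableTopology G] [LocallyCompactSpace G] [T2Space G] [MeasurableSpace G] [BorelSpace G]` and a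
Haar measure `μG`.  At `G := UnitaryGroup.localPi E c N J v` the first three are THEOREMS of the tree (★ `secondCountableTopology_localPi`, ★ `locallyCompactSpace_localPi`,
subtype separation), the measurable structure is taken as the Borel one (binders `[MeasurableSpace] [BorelSpace]`, the tree's convention — ★ `K2LiuDoublingHaarPinned`), and a
Haar measure EXISTS (Mathlib `Measure.haar`).  UNIMODULARITY (`[μG.IsMulRightInvariant]`) is NOT supplied here — it stays the by-value binder (m1) of my census 12:57Z.
* `t2Space_localPi`, `isTopologicalGroup_localPi` (inferable, recorded BY NAME for `haveI`);
* **`exists_isHaarMeasure_localPi`** — `∃ μ : Measure (localPi E c N J v), μ.IsHaarMeasure`; **`exists_isHaarMeasure_subgroup_of_isClosed`** — the same for a CLOSED subgroup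
  `P ≤ localPi …` (the parabolic `P′` of V8, (m4): closed ⇒ locally compact + second countable + T2), generic in the closed subgroup.
§2 (`continuous_rhoLoc_apply` ⇒ `hBcont` via ★ LETTER 1 `K2LiuLeviActionSmoothCoeff.continuous_coeff_leviEquivSB`) is appended when K2Liu-p09's I-2 `K2LiuA7ValueInstanceDefs` is ★.
References: [BorelJacquet1979, §4.1]; [Tan1999, §1]; [KudlaSweet1997, §1].
HONEST LABEL: HC_CM is proved only modulo the 7 printed citations (2 remaining named inputs: hLiu418 = stmt-HodgeConjecture-24832,
h413 = stmt-HodgeConjecture-24833) until rung 0 closes; count-neutral helper, closes no socket.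
-/

set_option autoImplicit false
set_option linter.dupNamespace false

noncomputable section

open MeasureTheory NumberField IsDedekindDomain
open Literature.NumberTheory.Automorphic

namespace Summit.HodgeConjecture.HodgeConjecture.Cruxes.HLiu418.K2LiuA7ValueInstanceContinuity

variable (F E : Type) [Field F] [NumberField F] [Field E] [NumberField E] [Algebra F E] (c : E ≃ₐ[F] E) (N : ℕ) (J : Matrix (Fin N) (Fin N) E)
  (v : HeightOneSpectrum (𝓞 F))

/-- `U(J)(F_v)` is Hausdorff (a subgroup of the Hausdorff group `Π_{w ∣ v} GL_N(E_w)`). [cite: BorelJacquet1979, §4.1] -/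
theorem t2Space_localPi : T2Space (UnitaryGroup.localPi E c N J v) := inferInstance

/-- `U(J)(F_v)` is a topological group (subgroup instance). [cite: BorelJacquet1979, §4.1] -/
theorem isTopologicalGroup_localPi : IsTopologicalGroup (UnitaryGroup.localPi E c N J v) := inferInstance

/-- **A HAAR MEASURE EXISTS ON `U(J)(F_v)`** (locally compact, Hausdorff, second countable — ★ tree lemmas — with its Borel σ-algebra). [cite: BorelJacquet1979, §4.1] -/
theorem exists_isHaarMeasure_localPi [MeasurableSpace (UnitaryGroup.localPi E c N J v)] [BorelSpace (UnitaryGroup.localPi E c N J v)] :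
    ∃ μ : Measure (UnitaryGroup.localPi E c N J v), μ.IsHaarMeasure := by
  haveI := UnitaryGroup.locallyCompactSpace_localPi E N c J v
  exact ⟨Measure.haar, inferInstance⟩

/-- **THE SAME BUNDLE ON A CLOSED SUBGROUP** `P ≤ U(J)(F_v)` (the parabolic `P′` of the Ikeda functional, (m4) of the census): closed ⇒ locally compact, second countable,
Hausdorff, and a Haar measure exists for its Borel σ-algebra. [cite: KudlaSweet1997, §1] [cite: BorelJacquet1979, §4.1] -/
theorem exists_isHaarMeasure_subgroup_of_isClosed (P : Subgroup (UnitaryGroup.localPi E c N J v)) (hP : IsClosed (P : Set (UnitaryGroup.localPi E c N J v)))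
    [MeasurableSpace P] [BorelSpace P] :
    LocallyCompactSpace P ∧ SecondCountableTopology P ∧ T2Space P ∧ ∃ μ : Measure P, μ.IsHaarMeasure := by
  haveI := UnitaryGroup.locallyCompactSpace_localPi E N c J v
  haveI := UnitaryGroup.secondCountableTopology_localPi E N c J v
  haveI : LocallyCompactSpace P := hP.isClosedEmbedding_subtypeVal.locallyCompactSpace
  haveI : SecondCountableTopology P := TopologicalSpace.Subtype.secondCountableTopology _
  exact ⟨inferInstance, inferInstance, inferInstance, Measure.haar, inferInstance⟩

/-- **LOCAL COMPACTNESS + SECOND COUNTABILITY OF `U(J)(F_v)` BY NAME** (re-export of the ★ tree lemmas in the argument order of this organ, for `haveI`). [cite: BorelJacquet1979, §4.1] -/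
theorem locallyCompactSpace_secondCountable_localPi :
    LocallyCompactSpace (UnitaryGroup.localPi E c N J v) ∧ SecondCountableTopology (UnitaryGroup.localPi E c N J v) :=
  ⟨UnitaryGroup.locallyCompactSpace_localPi E N c J v, UnitaryGroup.secondCountableTopology_localPi E N c J v⟩

end Summit.HodgeConjecture.HodgeConjecture.Cruxes.HLiu418.K2LiuA7ValueInstanceContinuity

end
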